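import Literature.AnabelianGeometry.AbsoluteAnabelian.AbsTopIII.FrobeniusPictureMLFTelecore
import HarnessLib

/-!
# [AbsTopIII] §4, Corollary 4.5 (Aut-holomorphic mono-anabelian log-Frobenius compatibility),
# Remark 4.5.2 and Remark 4.5.3 (i)

Mochizuki, *Topics in Absolute Anabelian Geometry III*, §4, Corollary 4.5 pp. 107–110, Remark 4.5.2
pp. 111–112, Remark 4.5.3 (i) p. 112 of the author's kurims manuscript (lit key
`paper:url-5493eb38cbb7`; journal pagination not held).  Bib key `MochizukiAbsTopIII2015`.  Block
W2-B4 of the abc-iut cell (nodes `AbsTopIII:Cor4.5(i)`–`(v)`, `AbsTopIII:Rmk4.5.2`,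
`AbsTopIII:Rmk4.5.3(i)` [recorded]); the other Remarks 4.5.x are in
`AbsTopIII/ArchLogFrobeniusRemarks.lean`.

## How Corollary 4.5 is typed (cell ruling ν, 2026-08-25)

Cor. 4.5 is, word for word, Cor. 3.6 (pp. 78–80) for the ARCHIMEDEAN input data: "Write
`𝒳 := 𝒞^hol_T`, `ℰ := EA`, `𝒩 := 𝒞^hol_{TH}` — where `T ∈ {TM, TF}`", the first row the `log`-chain of
copies of `𝒳` (`log = 𝔩𝔬𝔤_{T,T}` of Def. 4.1 (iv), "isomorphic to the identity functor", Prop. 4.2 (ii)),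
`λ^×, λ^∼ : 𝒳 → 𝒩`, `κ_LH : ℰ → LinHol` the equivalence of Def. 4.1 (v), `φ_LH : LinHol → 𝒳` the
forgetful equivalence of Cor. 4.5 (ii) with `η_LH : φ_LH ∘ π_LH ⥲ id_𝒳`, and the natural
transformations `ι_log,⋎ : λ^× ∘ id_⋎ ∘ log → λ^∼ ∘ id_{⋎+1}`, `ι_× : λ^∼ → λ^×` of Def. 4.1 (iv).  The
six-row diagram `𝒟` and its truncations over ABSTRACT input data `Δ : LogFrobeniusData`
(categories + functors + natural transformations; Def. 3.5 vocabulary of `DiagramsOfCategories.lean`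
/ `DiagramMorphisms.lean`) are `LogFrobeniusDiagram.lean` (seat abc-iut-L4-t2); the statements
(i)–(v) of Cor. 3.6 over `Δ` and the first-row telecore data `τ : Δ.TelecoreData`
(`= ⟨φ_LH, unitor, η_LH⟩` in print, where the first row is `𝒳` itself) are
`AbsTopIII/FrobeniusPictureMLF.lean` + `AbsTopIII/FrobeniusPictureMLFTelecore.lean` (seat
abc-iut-L4-t5; `CoreStmt4/5/6`, `TelecoreStmt`, `ObservableLogStmt`, `IncompatibleStmt`,
`TelecoreIncompatibleStmt`, `NexusRigidStmt`, `ShiftStmt`, assembled as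
`LogFrobeniusCompatible Δ τ`), imported and never re-declared.  The archimedean case is
distinguished inside the data by the DIRECTION of `ι_×` — the right summand `λ^∼ ⟶ λ^×` of
`LogFrobeniusData.ιtimes` ("certain — but not all! — of the 'arrows' that appear in the archimedean
case go in the opposite direction to the nonarchimedean case … perhaps the most important example of
this phenomenon is given by `ι_×`", Rmk. 4.5.2; the basic pair of `𝔖_log` at `□` is then
`([λ^∼], [λ^×])`, as `timesPairLeft/Right` provide) — and by `𝒜 = LinHol`.  Accordingly:

* `Cor_4_5 Δ τ := Δ.LogFrobeniusCompatible τ` and one named `Prop` per printed item, `Cor_4_5_i` …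
  `Cor_4_5_v`, with `cor_4_5_iff` (PROVED) tying them to the structure — typing shape (1) of the
  cell's policy θ: statements over abstract input data, consumed by name; the INSTANCE "the data of
  Def. 4.1 arising from elliptically admissible Aut-holomorphic orbispaces" is not constructed in the
  tree (Def. 4.1 (iii)'s categories `𝒞^hol_T`, `EA` are not yet Mathlib categories —
  `ArchimedeanLogFrobenius.lean`), exactly as for Cor. 3.6.
* NEW here, specific to §4: the full generating family of the observable `𝔖_log` of Cor. 4.5 (iii)
  — the homotopies of the FOUR types (1)–(4) of the proof (pp. 109–110), for every `n ≥ 1`, obtained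
  "by composing, in an alternating fashion, various pull-backs of `ι_log,⋎` with various pull-backs
  of `ι_×`" — CONSTRUCTED (`slogHom₁` … `slogHom₄`, the first one as a natural transformation
  `slogNatTrans₁`); Rmk. 4.5.2's contrast "archimedean homotopies of arbitrarily large length" vs.
  "nonarchimedean paths of bounded length" made checkable (`archPairLength_unbounded`,
  `nonarchPairLength_le`, `Rmk_4_5_2_directions`).
* In the companion file `AutHolLogFrobeniusIncompatibility.lean`: **Cor. 4.5 (iv), first
  incompatibility, DERIVED** from the component-level content of Lemma 4.4 by the printed argument
  "`ζ'₁ = ζ₂ ∘ ζ₁ ∘ ζ'₀` … must coincide with the identity homotopy … a contradiction to Lemma 4.4" run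
  inside the axioms of a family of homotopies (Def. 3.5 (ii)): `incompatibleStmt_of_lemma44`.
* `AbsTopIII:Rmk4.5.3(i)` (p. 112) — "By replacing `λ^{×pf}` by `λ^∼`, `ι_× : λ^× → λ^{×pf}` by
  `ι_× : λ^∼ → λ^×`, and 'Corollary 1.10' by 'Corollary 2.7', [and making various other suitable
  revisions] one obtains an essentially straightforward 'Aut-holomorphic translation' of the
  bi-anabelian incompatibility result given in Corollary 3.7. We leave the routine details to the
  reader."  RECORDED, not typed separately: Cor. 3.7 is typed over seat abc-iut-L4-t9's
  `BiAnabelianSetting` (`AbsTopIII/MonoAnabelianComparisonMLF.lean`), whose field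
  `iotaTimes : lamTimes ⟶ lamTimesPf` fixes the §3 direction; the translation is the same list of
  statements (`Cor_3_7_i` … `Cor_3_7_v` there) over a setting with `iotaTimes : lamTimesPf ⟶ lamTimes`
  and the `θ^bi` of Cor. 2.7 in place of Cor. 1.10.
  -- TODO(general form): a direction flag on `BiAnabelianSetting` (as `LogFrobeniusData.ιtimes`)
  -- would make Rmk. 4.5.3 (i) the literal specialisation; to be requested from abc-iut-L4-t9.

Nothing here asserts any of these statements for the geometric data; typed ≠ discharged.
-/

namespace Literature.AnabelianGeometry.AbsoluteAnabelian.AbsTopIII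

open _root_.CategoryTheory _root_.Quiver

universe u

/-! ### Corollary 4.5 (i)–(v) as named statements over the input data -/

section Statements

variable (Δ : LogFrobeniusData.{u}) (τ : Δ.TelecoreData)

/-- **Cor. 4.5 (i)**: "For `n = 4, 5, 6`, `𝒟_{≤n}` admits a natural structure of core on `𝒟_{≤n−1}`.
That is to say, loosely speaking, `ℰ`, `LinHol` 'form cores' of the functors in `𝒟`" — the pinned
observables `(𝒟_{≤4}, ℰ)`, `(𝒟_{≤5}, 𝒜 = LinHol)`, `(𝒟_{≤6}, ℰ)` admit core structures
(`CoreStmt4/5/6` of `FrobeniusPictureMLF.lean`).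
[cite: MochizukiAbsTopIII2015, Corollary 4.5 (i) p.108] -/
def Cor_4_5_i : Prop := Δ.CoreStmt4 ∧ Δ.CoreStmt5 ∧ Δ.CoreStmt6

/-- **Cor. 4.5 (ii)**: the forgetful functor `φ_LH : LinHol → 𝒳`, "an equivalence of categories, a
quasi-inverse for which is given by the composite `π_LH : 𝒳 → LinHol` of the natural projection
functor `𝒳 → ℰ` with `κ_LH : ℰ → LinHol`" (data: `Δ.φ`, `Δ.φ_equiv`, `Δ.η`), "gives rise to a telecore
structure `𝔗_LH` on `𝒟_{≤4}` … by appending to `𝒟_{≤5}` telecore edges `φ_⋏ : LinHol → 𝒳`" for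
`⋏ ∈ L† = L ∪ {□}`, and "the collection of natural transformations `{η_□⋎, η_□⋎⁻¹, η_⋏, η_⋏⁻¹}` …
generate[s] a contact structure `ℋ_LH` on the telecore `𝔗_LH`" (`TelecoreStmt` of
`FrobeniusPictureMLFTelecore.lean`, over the first-row telecore data `τ`; in print
`τ = ⟨φ_LH, unitor, η_LH⟩`).
[cite: MochizukiAbsTopIII2015, Corollary 4.5 (ii) p.108] -/
def Cor_4_5_ii : Prop := Δ.TelecoreStmt τ

/-- **Cor. 4.5 (iii)**: "The natural transformations `ι_log,⋎ : λ^× ∘ id_⋎ ∘ log → λ^∼ ∘ id_{⋎+1}`,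
`ι_× : λ^∼ → λ^×` belong to a family of homotopies on `𝒟_{≤3}` that determines on `𝒟_{≤3}` a structure
of observable `𝔖_log` on `𝒟_{≤2}`" (`ObservableLogStmt`; for archimedean data the basic pair at `□`
is `([λ^∼], [λ^×])` with homotopy `ι_×` — the `timesPairLeft/Right` of the right-summand branch).
The compatibility "with the families of homotopies that constitute the core and telecore structures
of (i), (ii)" is recorded, not typed (as in Cor. 3.6 (iii)).  The generating homotopies of all
lengths are constructed below (`slogHom₁`–`slogHom₄`).
[cite: MochizukiAbsTopIII2015, Corollary 4.5 (iii) pp.108–109] -/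
def Cor_4_5_iii : Prop := Δ.ObservableLogStmt

/-- **Cor. 4.5 (iv)**: "The diagram of categories `𝒟_{≤2}` does not admit a structure of core on
`𝒟_{≤1}` which [i.e., whose constituent family of homotopies] is compatible with [the constituent
family of homotopies of] the observable `𝔖_log` of (iii)" (`IncompatibleStmt`; DERIVED from the
Lemma-4.4 property in `AutHolLogFrobeniusIncompatibility.lean`).  "Moreover, the telecore structure
`𝔗_LH` of (ii), the contact structure `ℋ_LH` of (ii), and the observable `𝔖_log` of (iii) are not
simultaneously compatible" (`TelecoreIncompatibleStmt τ`).
[cite: MochizukiAbsTopIII2015, Corollary 4.5 (iv) p.109] -/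
def Cor_4_5_iv : Prop := Δ.IncompatibleStmt ∧ Δ.TelecoreIncompatibleStmt τ

/-- **Cor. 4.5 (v)**: "The unique vertex `□` of the second row of `𝒟` is a nexus of `Γ⃗_𝒟`. Moreover,
`𝒟` is totally `□`-rigid, and the natural action of `ℤ` on the infinite linear oriented graph
`Γ⃗_{𝒟≤1}` extends to an action of `ℤ` on `𝒟` by nexus-classes of self-equivalences of `𝒟`"
(`NexusRigidStmt ∧ ShiftStmt`); the compatibilities of these self-equivalences with the families of
homotopies of (i)–(iii) and their extension to the telecore are recorded, not typed (as in Cor. 3.6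
(v)).
[cite: MochizukiAbsTopIII2015, Corollary 4.5 (v) p.109] -/
def Cor_4_5_v : Prop := Δ.NexusRigidStmt ∧ Δ.ShiftStmt

/-- **Corollary 4.5 (Aut-Holomorphic Mono-anabelian Log-Frobenius Compatibility)** for the input
data `Δ` and first-row telecore data `τ` — LITERALLY the `Prop`-valued structure
`LogFrobeniusCompatible` of Cor. 3.6 (the archimedean data has `ι_×` in the right summand of
`Δ.ιtimes`, `𝒜 = LinHol`, `τ = ⟨φ_LH, unitor, η_LH⟩`).  Named `Prop`; nothing is asserted.
[cite: MochizukiAbsTopIII2015, Corollary 4.5 pp.107–109] -/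
def Cor_4_5 : Prop := Δ.LogFrobeniusCompatible τ

/-- `Cor_4_5` is the conjunction of its five printed items.
[cite: MochizukiAbsTopIII2015, Corollary 4.5 pp.107–109] -/
theorem cor_4_5_iff :
    Cor_4_5 Δ τ ↔ Cor_4_5_i Δ ∧ Cor_4_5_ii Δ τ ∧ Cor_4_5_iii Δ ∧ Cor_4_5_iv Δ τ ∧ Cor_4_5_v Δ := by
  constructor
  · rintro ⟨c4, c5, c6, tel, obs, inc, inct, nex, sh⟩
    exact ⟨⟨c4, c5, c6⟩, tel, obs, ⟨inc, inct⟩, nex, sh⟩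
  · rintro ⟨⟨c4, c5, c6⟩, tel, obs, ⟨inc, inct⟩, nex, sh⟩
    exact ⟨c4, c5, c6, tel, obs, inc, inct, nex, sh⟩

/-- The input data is of **Aut-holomorphic (archimedean) type**: `ι_×` goes "in the opposite
direction", `λ^∼ → λ^×` (right summand of `ιtimes`).
[cite: MochizukiAbsTopIII2015, Remark 4.5.2 pp.111–112] -/
def IsAutHolDirection : Prop := ∃ ι : Δ.lamPf ⟶ Δ.lamTimes, Δ.ιtimes = Sum.inr ι

end Statements

/-! ### Corollary 4.5 (iii), proof: the generating homotopies of `𝔖_log` of all four types -/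

section Observable

variable {Δ : LogFrobeniusData.{u}} (ι : Δ.lamPf ⟶ Δ.lamTimes)

/-- Iterates `Fⁿ` of an endofunctor (`F⁰ = 𝟭`, `Fⁿ⁺¹ = F ⋙ Fⁿ`), used for the powers `[log]ⁿ` of the
first row of `𝒟` ("`[λ^×]∘[id_⋎]∘[log]ⁿ`", proof of Cor. 4.5 (iii)).
[cite: MochizukiAbsTopIII2015, Corollary 4.5 (iii) p.109] -/
def iterFunctor {C : Type u} [Category.{u} C] (F : C ⥤ C) : ℕ → (C ⥤ C)
  | 0 => 𝟭 C
  | n + 1 => F ⋙ iterFunctor F n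

/-- On objects `Fⁿ` is the `n`-fold iterate of `F.obj` (`logⁿ` on the typical object).
[cite: MochizukiAbsTopIII2015, Corollary 4.5 (iii) p.109] -/
theorem iterFunctor_obj {C : Type u} [Category.{u} C] (F : C ⥤ C) (n : ℕ) (x : C) :
    (iterFunctor F n).obj x = F.obj^[n] x := by
  induction n generalizing x with
  | zero => rfl
  | succ n ih => exact ih (F.obj x)

/-- The component of `ι_log,⋎` at an object, with its source written out (`λ^×(id(log x))`).
[cite: MochizukiAbsTopIII2015, Definition 4.1 (iv) p.104] -/
def ιlogApp (x : Δ.X₁) :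
    (Δ.lamTimes.obj (Δ.toNexus.obj (Δ.log.obj x)) ⟶ Δ.lamPf.obj (Δ.toNexus.obj x)) :=
  Δ.ιlog.app x

/-- `ιlogApp` is `ι_log.app`. [cite: MochizukiAbsTopIII2015, Definition 4.1 (iv) p.104] -/
theorem ιlogApp_eq (x : Δ.X₁) : ιlogApp (Δ := Δ) x = Δ.ιlog.app x := rfl

/-- Type (1) homotopies (proof of Cor. 4.5 (iii), p. 109): "the path corresponding to the composite
`k^×_⋎ → k~_{⋎+n}`", a homotopy for the pair `([λ^×]∘[id_⋎]∘[log]ⁿ, [λ^∼]∘[id_{⋎+n}])`, obtained "by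
composing, in an alternating fashion, various pull-backs of `ι_log,⋎` with various pull-backs of
`ι_×`": components `λ^×(id(logⁿ⁺¹ x)) ⟶ λ^∼(id x)` (index shifted so that every `n : ℕ` is allowed:
`slogHom₁ ι n` has `n + 1` factors `log`).
[cite: MochizukiAbsTopIII2015, Corollary 4.5 (iii) p.109] -/
def slogHom₁ : ∀ (n : ℕ) (x : Δ.X₁),
    (Δ.lamTimes.obj (Δ.toNexus.obj ((iterFunctor Δ.log (n + 1)).obj x)) ⟶
      Δ.lamPf.obj (Δ.toNexus.obj x))
  | 0, x => ιlogApp x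
  | n + 1, x => slogHom₁ n (Δ.log.obj x) ≫ ι.app (Δ.toNexus.obj (Δ.log.obj x)) ≫ ιlogApp x

/-- The recursion of type (1): `k^×_⋎ → k~_{⋎+n+1}` is `k^×_⋎ → k~_{⋎+n} ↠ k^×_{⋎+n} ↪ k~_{⋎+n+1}`
(`ι_×` then `ι_log`).
[cite: MochizukiAbsTopIII2015, Corollary 4.5 (iii) p.109] -/
theorem slogHom₁_succ (n : ℕ) (x : Δ.X₁) :
    slogHom₁ ι (n + 1) x =
      slogHom₁ ι n (Δ.log.obj x) ≫ ι.app (Δ.toNexus.obj (Δ.log.obj x)) ≫ ιlogApp x :=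
  rfl

/-- Type (2) homotopies: "the composite `k^×_⋎ → k^×_{⋎+n}`", for the pair
`([λ^×]∘[id_⋎]∘[log]ⁿ, [λ^×]∘[id_{⋎+n}])` — type (1) followed by `ι_×`.
[cite: MochizukiAbsTopIII2015, Corollary 4.5 (iii) p.109] -/
def slogHom₂ (n : ℕ) (x : Δ.X₁) :
    (Δ.lamTimes.obj (Δ.toNexus.obj ((iterFunctor Δ.log (n + 1)).obj x)) ⟶
      Δ.lamTimes.obj (Δ.toNexus.obj x)) :=
  slogHom₁ ι n x ≫ ι.app (Δ.toNexus.obj x)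

/-- Type (3) homotopies: "the composite `k~_⋎ → k~_{⋎+n}`", for the pair
`([λ^∼]∘[id_⋎]∘[log]ⁿ, [λ^∼]∘[id_{⋎+n}])` — `ι_×` followed by type (1).
[cite: MochizukiAbsTopIII2015, Corollary 4.5 (iii) p.109] -/
def slogHom₃ (n : ℕ) (x : Δ.X₁) :
    (Δ.lamPf.obj (Δ.toNexus.obj ((iterFunctor Δ.log (n + 1)).obj x)) ⟶
      Δ.lamPf.obj (Δ.toNexus.obj x)) :=
  ι.app (Δ.toNexus.obj ((iterFunctor Δ.log (n + 1)).obj x)) ≫ slogHom₁ ι n x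

/-- Type (4) homotopies: "the composite `k~_⋎ → k^×_{⋎+n−1}`", for the pair
`([λ^∼]∘[id_⋎]∘[log]ⁿ⁻¹, [λ^×]∘[id_{⋎+n−1}])`, `n ≥ 1`; for `n = 1` "it is convenient to include also
the pair of paths `([λ^∼], [λ^×])`, for which the natural transformation `ι_×` determines a homotopy".
Indexed here by `m = n − 1 ∈ ℕ` (number of factors `log`).
[cite: MochizukiAbsTopIII2015, Corollary 4.5 (iii) p.110] -/
def slogHom₄ : ∀ (m : ℕ) (x : Δ.X₁),
    (Δ.lamPf.obj (Δ.toNexus.obj ((iterFunctor Δ.log m).obj x)) ⟶ Δ.lamTimes.obj (Δ.toNexus.obj x))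
  | 0, x => ι.app (Δ.toNexus.obj x)
  | m + 1, x => ι.app (Δ.toNexus.obj ((iterFunctor Δ.log (m + 1)).obj x)) ≫ slogHom₂ ι m x

/-- Type (4) with at least one `log` is type (3) followed by `ι_×`.
[cite: MochizukiAbsTopIII2015, Corollary 4.5 (iii) p.110] -/
theorem slogHom₄_succ (m : ℕ) (x : Δ.X₁) :
    slogHom₄ ι (m + 1) x = slogHom₃ ι m x ≫ ι.app (Δ.toNexus.obj x) := by
  simp only [slogHom₄, slogHom₂, slogHom₃, Category.assoc]

/-- The type (1) homotopies are natural in the object: they form a natural transformation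
`λ^× ∘ id ∘ logⁿ⁺¹ ⟶ λ^∼ ∘ id` of functors `𝒳₁ ⥤ 𝒩` (the homotopy `ζ_ϖ` of Def. 3.5 (ii) (b)).
[cite: MochizukiAbsTopIII2015, Corollary 4.5 (iii) p.109] -/
theorem slogHom₁_naturality (n : ℕ) {x y : Δ.X₁} (f : x ⟶ y) :
    Δ.lamTimes.map (Δ.toNexus.map ((iterFunctor Δ.log (n + 1)).map f)) ≫ slogHom₁ ι n y =
      slogHom₁ ι n x ≫ Δ.lamPf.map (Δ.toNexus.map f) := by
  induction n generalizing x y with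
  | zero => exact Δ.ιlog.naturality f
  | succ n ih =>
    have h1 := ih (Δ.log.map f)
    have h2 := ι.naturality (Δ.toNexus.map (Δ.log.map f))
    have h3 : Δ.lamTimes.map (Δ.toNexus.map (Δ.log.map f)) ≫ ιlogApp y =
        ιlogApp x ≫ Δ.lamPf.map (Δ.toNexus.map f) := Δ.ιlog.naturality f
    show Δ.lamTimes.map (Δ.toNexus.map ((iterFunctor Δ.log (n + 1)).map (Δ.log.map f))) ≫
        slogHom₁ ι n (Δ.log.obj y) ≫ ι.app (Δ.toNexus.obj (Δ.log.obj y)) ≫ ιlogApp y =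
      (slogHom₁ ι n (Δ.log.obj x) ≫ ι.app (Δ.toNexus.obj (Δ.log.obj x)) ≫ ιlogApp x) ≫
        Δ.lamPf.map (Δ.toNexus.map f)
    rw [← Category.assoc, h1]
    simp only [Category.assoc]
    rw [← Category.assoc (Δ.lamPf.map _), h2]
    simp only [Category.assoc]
    rw [h3]

/-- The type (1) homotopies as a natural transformation `(logⁿ⁺¹ ⋙ id) ⋙ λ^× ⟶ id ⋙ λ^∼`.
[cite: MochizukiAbsTopIII2015, Corollary 4.5 (iii) p.109] -/
def slogNatTrans₁ (n : ℕ) :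
    (iterFunctor Δ.log (n + 1) ⋙ Δ.toNexus) ⋙ Δ.lamTimes ⟶ Δ.toNexus ⋙ Δ.lamPf where
  app := slogHom₁ ι n
  naturality _ _ f := slogHom₁_naturality ι n f

/-- Type (2) as a natural transformation: type (1) followed by `ι_×` whiskered by `id`.
[cite: MochizukiAbsTopIII2015, Corollary 4.5 (iii) p.109] -/
def slogNatTrans₂ (n : ℕ) :
    (iterFunctor Δ.log (n + 1) ⋙ Δ.toNexus) ⋙ Δ.lamTimes ⟶ Δ.toNexus ⋙ Δ.lamTimes :=
  slogNatTrans₁ ι n ≫ Functor.whiskerLeft Δ.toNexus ι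

/-- Type (3) as a natural transformation: `ι_×` whiskered by `logⁿ⁺¹ ⋙ id`, followed by type (1).
[cite: MochizukiAbsTopIII2015, Corollary 4.5 (iii) p.109] -/
def slogNatTrans₃ (n : ℕ) :
    (iterFunctor Δ.log (n + 1) ⋙ Δ.toNexus) ⋙ Δ.lamPf ⟶ Δ.toNexus ⋙ Δ.lamPf :=
  Functor.whiskerLeft (iterFunctor Δ.log (n + 1) ⋙ Δ.toNexus) ι ≫ slogNatTrans₁ ι n

/-- Type (4) (with `m + 1 ≥ 1` factors `log`) as a natural transformation: `ι_×` whiskered, followed by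
type (2); the case without `log` is `ι_×` itself (whiskered by `id`).
[cite: MochizukiAbsTopIII2015, Corollary 4.5 (iii) p.110] -/
def slogNatTrans₄ (m : ℕ) :
    (iterFunctor Δ.log (m + 1) ⋙ Δ.toNexus) ⋙ Δ.lamPf ⟶ Δ.toNexus ⋙ Δ.lamTimes :=
  Functor.whiskerLeft (iterFunctor Δ.log (m + 1) ⋙ Δ.toNexus) ι ≫ slogNatTrans₂ ι m

/-- The components of `slogNatTrans₄` are the `slogHom₄` (with at least one `log`).
[cite: MochizukiAbsTopIII2015, Corollary 4.5 (iii) p.110] -/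
theorem slogNatTrans₄_app (m : ℕ) (x : Δ.X₁) :
    (slogNatTrans₄ ι m).app x = slogHom₄ ι (m + 1) x := by
  simp only [slogNatTrans₄, slogNatTrans₂, slogNatTrans₁, slogHom₄, slogHom₂, NatTrans.comp_app,
    Functor.whiskerLeft_app]
  rfl

end Observable

/-! ### Remark 4.5.2: directions and lengths -/

/-- **Remark 4.5.2**, lengths in the archimedean case: the "non-`[γ]`-portions" of the pairs of paths
of types (1), (2), (3), (4) of the proof of Cor. 4.5 (iii) have lengths `(n+2, 2)`, `(n+2, 2)`,
`(n+2, 2)`, `(n+1, 2)` (number of edges of `[λ^?]∘[id_⋎]∘[log]ⁿ` resp. `[λ^?]∘[id_⋎]∘[log]ⁿ⁻¹`, and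
of `[λ^?]∘[id_{⋎'}]`), for every `n ≥ 1` — "archimedean homotopies of arbitrarily large 'length'".
[cite: MochizukiAbsTopIII2015, Remark 4.5.2 pp.111–112] -/
def archPairLength : Fin 4 → ℕ → ℕ × ℕ
  | 0, n => (n + 2, 2)
  | 1, n => (n + 2, 2)
  | 2, n => (n + 2, 2)
  | 3, n => (n + 1, 2)

/-- **Remark 4.5.2**, lengths in the nonarchimedean case: the pairs of types (1), (2) of the proof of
Cor. 3.6 (iii) (p. 81), `([λ^×]∘[id_⋎]∘[log], [λ^{×pf}]∘[id_{⋎+1}])` and `([λ^×], [λ^{×pf}])`, have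
non-`[γ]`-portions of lengths `(3, 2)` and `(1, 1)` — "nonarchimedean paths of bounded 'length'".
[cite: MochizukiAbsTopIII2015, Remark 4.5.2 p.112] -/
def nonarchPairLength : Fin 2 → ℕ × ℕ
  | 0 => (3, 2)
  | 1 => (1, 1)

/-- Rmk. 4.5.2: the archimedean lengths are unbounded.
[cite: MochizukiAbsTopIII2015, Remark 4.5.2 pp.111–112] -/
theorem archPairLength_unbounded (N : ℕ) : ∃ (t : Fin 4) (n : ℕ), N < (archPairLength t n).1 :=
  ⟨0, N, by simp [archPairLength]⟩

/-- Rmk. 4.5.2: the nonarchimedean lengths are bounded by `3`.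
[cite: MochizukiAbsTopIII2015, Remark 4.5.2 p.112] -/
theorem nonarchPairLength_le (t : Fin 2) : (nonarchPairLength t).1 ≤ 3 ∧ (nonarchPairLength t).2 ≤ 3 := by
  revert t
  decide

/-- **Remark 4.5.2**, directions: "certain — but not all! — of the 'arrows' that appear in the
archimedean case go in the opposite direction to the nonarchimedean case … perhaps the most important
example of this phenomenon is given by `ι_×`" — in the input data, the §3 case has `ι_×` in the LEFT
summand (`λ^× → λ^{×pf}`), the §4 case in the RIGHT summand (`λ^∼ → λ^×`) of `ιtimes`, while `ι_log`
keeps its direction; the two cases are mutually exclusive.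
[cite: MochizukiAbsTopIII2015, Remark 4.5.2 p.111] -/
theorem Rmk_4_5_2_directions (Δ : LogFrobeniusData.{u}) :
    IsAutHolDirection Δ ↔ ¬ ∃ ι : Δ.lamTimes ⟶ Δ.lamPf, Δ.ιtimes = Sum.inl ι := by
  constructor
  · rintro ⟨ι, h⟩ ⟨ι', h'⟩
    rw [h] at h'
    cases h'
  · intro h
    rcases hΔ : Δ.ιtimes with ι | ι
    · exact (h ⟨ι, hΔ⟩).elim
    · exact ⟨ι, hΔ⟩

end Literature.AnabelianGeometry.AbsoluteAnabelian.AbsTopIII
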